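import Summits.BirchSwinnertonDyer.BirchSwinnertonDyer.Theorems.PrintCFramBottomClassIndexLawFiveLeFlipRungSupply
import Summits.BirchSwinnertonDyer.BirchSwinnertonDyer.Theorems.PrintCFramBottomClassIndexLawFiveLeCohenCutIntegrality
import Summits.BirchSwinnertonDyer.BirchSwinnertonDyer.Theorems.PrintCFramBottomClassIndexLawFiveLeThetaCycleLegendreDescent
import HarnessLib

/-!
# Crux `PrintCFram.BottomClassIndexLawFiveLe` (stmt-BirchSwinnertonDyer-20372), line `eisenstein-resource-bdp-line` (registry v26 → v27):
# THE FLIPPED-CUSP RUNG, piece T5 layer A — (FlipRung⁶) ⟸ (Rung⁶): THE RUNG IN COHEN-NUMBER CURRENCY IMPLIES THE RUNG IN BERNOULLI CURRENCY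
# (cell `bsd-print-cfram`, width seat `bsd-line-cfram-p1-w8` g9; THEOREMS ONLY, `--supports` 20372; BSD is not proved by any of this)

HONEST FRAMING. Nothing here is a statement about BSD; no registered stub is closed. Registry v27 (LEAD g14) replaces v26's analytic
residue `stub_seedOffExc` by the print-derivable `stub_flipRung` = (FlipRung⁶), the `hFlip` binder of
`FlipRung.seedOffExc_of_flipRung_of_bad` (p706253), ∧ a thin research residue. (FlipRung⁶) speaks of generalised Bernoulli numbers
`k⁻¹B_k((χ↑ε₀↑)~)` at imaginary quadratic fields `K₀`; its typing (crux notes lead-g14 §2.1: Cohen 1975 Thm 3.1, the finite Fourier lemma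
T1, the matrix factorisation T2, the slash computation T3, Katz 1973 Cor 1.6.2 at the flipped cusp T4) lives on the MODULAR side, where the
natural statement is about the COEFFICIENTS `H(k, a)` of Cohen's `H_k` on the `(3,0)`-refined `m`-cut. This file is the DICTIONARY LAYER
of the assembly T5: it states the rung in Cohen-number currency, (Rung⁶) — «for a class datum, a sign pattern `τ` on the odd primes of `m`
and an odd `q ∣ m` with `q* ≢ 1 (mod p)`: if `‖H(k, a)‖_p ≤ p⁻¹` at EVERY index `a = m·n'` of the `τ`-cut (`n' ≡ 3 (4)`,
`J(−n' | q') = τ(q')` at the odd `q' ∣ m`, `n' ≡ 7 (8)` if `2 ∣ m`, `3 ∤ n'`), then the same holds on the cut with `τ` FLIPPED at `q`» —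
and PROVES **`flipRung_six_of_rung : (Rung⁶) → (FlipRung⁶)`** (the target of T1–T4 + T5 layer B is therefore (Rung⁶), `K₀`-free and
`χ`-light). The proof is w4 g12's Cohen dictionary on the cut (`H(k, m n₀ f²) = −T_k(D', f)·k⁻¹B_k((χ↑ε_K↑)~)`, `T ∈ ℤ`, `T = 1` at
`f = 1`) re-keyed from the all-split Jacobi clauses `J = 1` to an arbitrary `±1`-pattern (§1–§2: only the coprimality `gcd(m, n₀) = 1`
is used), w5 g5's descent of a cut index to the field `ℚ(√−n₀)` (`…CuspSeedCutForm` §1 idiom), and pure logic (§3).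

* §1 `coprime_of_cut_sign` (a `±1`-pattern forces `gcd(m, n₀) = 1`), `jacobiSym_neg_eq_of_neg_mul_sq` (`J(−n₀f² | q) = ±1 ⟹ J(−n₀ | q)`
  is the same sign);
* §2 `ratCast_cohenH_cut_eq_of_coprime` (the dictionary keyed on coprimality), `norm_ratCast_cohenH_cut_le_of_norm_bernoulli_le`
  (non-unit field factor ⟹ `‖H(k, m n₀ f²)‖ ≤ p⁻¹`), `norm_bernoulli_eq_norm_ratCast_cohenH` (`f = 1`: `‖k⁻¹B‖ = ‖H(k, m n₀)‖`);
* §3 **`flipRung_six_of_rung`**.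

No definitions, no named facts, no `sorry`. beyond-print theorem: NO (dictionary / plumbing).
References: [Cohen1975] §2 (definition of `H(r, N)`), Thm. 3.1; [Washington1997] Thm. 4.2; crux notes `Lines/eisenstein-resource-bdp-line-lead-g14.md` §2.
-/

set_option autoImplicit false
-- summit-side namespace `Summit.BirchSwinnertonDyer.BirchSwinnertonDyer.…` (single-conjunct summit, D-0017 layout)
set_option linter.dupNamespace false

noncomputable section

open scoped Classical NumberTheorySymbols
open NumberField DirichletCharacter Literature.NumberTheory.LFunctions
  Literature.NumberTheory.ModularForms.CohenEisenstein
  Literature.NumberTheory.EllipticCurves Literature.NumberTheory.EllipticCurves.KrizLi2019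
  Literature.NumberTheory.QuadraticFields

namespace Summit.BirchSwinnertonDyer.BirchSwinnertonDyer.Theorems.PrintCFram.FlipRung

open Summit.BirchSwinnertonDyer.BirchSwinnertonDyer.Theorems.PrintCFram

/-! ## §1 Sign patterns on the cut -/

/-- **A `±1`-valued Jacobi pattern on the cut forces `gcd(m, n₀) = 1`**: at an odd prime `q ∣ m`, `J(−n₀f² | q) = τ(q) = ±1 ≠ 0`
gives `q ∤ n₀`, and `2 ∤ n₀` as `n₀ ≡ 3 (mod 4)` (w4 g12's `CohenCut.coprime_of_cut`, re-keyed from `J = 1` to `J = ±1`).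
[cite: Cohen1975, Thm. 3.1] -/
theorem coprime_of_cut_sign {m n₀ f : ℕ} {τ : ℕ → ℤ} (h4 : n₀ % 4 = 3)
    (hτ : ∀ q : ℕ, q.Prime → q ∣ m → q ≠ 2 → (τ q = 1 ∨ τ q = -1))
    (hJ : ∀ q : ℕ, q.Prime → q ∣ m → q ≠ 2 → jacobiSym (-((n₀ * f ^ 2 : ℕ) : ℤ)) q = τ q) : m.Coprime n₀ := by
  refine Nat.Coprime.symm (Nat.coprime_of_dvd fun q hq hqn hqm => ?_)
  by_cases hq2 : q = 2
  · subst hq2; omega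
  · haveI : NeZero q := ⟨hq.ne_zero⟩
    have h1 := hJ q hq hqm hq2
    have h0 : jacobiSym (-((n₀ * f ^ 2 : ℕ) : ℤ)) q = 0 := by
      refine jacobiSym.eq_zero_iff_not_coprime.mpr fun hg => ?_
      rw [Int.gcd_eq_natAbs, Int.natAbs_neg, Int.natAbs_natCast, Int.natAbs_natCast] at hg
      have hdvd : q ∣ Nat.gcd (n₀ * f ^ 2) q := Nat.dvd_gcd (hqn.mul_right _) dvd_rfl
      rw [hg] at hdvd
      exact hq.one_lt.ne' (Nat.dvd_one.mp hdvd)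
    rw [h0] at h1
    rcases hτ q hq hqm hq2 with h | h <;> rw [h] at h1 <;> norm_num at h1

/-- **`J(−n₀f² | q) = ±1 ⟹ J(−n₀ | q) = ±1` with the same sign** (`J(f | q)² = 1` as soon as it is non-zero).
[cite: IrelandRosen1990, Prop. 5.2.2] -/
theorem jacobiSym_neg_eq_of_neg_mul_sq {n₀ f q : ℕ} {t : ℤ} (ht : t = 1 ∨ t = -1)
    (h : jacobiSym (-((n₀ * f ^ 2 : ℕ) : ℤ)) q = t) : jacobiSym (-(n₀ : ℤ)) q = t := by
  have hcast : (-((n₀ * f ^ 2 : ℕ) : ℤ)) = (-(n₀ : ℤ)) * (f : ℤ) ^ 2 := by push_cast; ring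
  rw [hcast, jacobiSym.mul_left, jacobiSym.pow_left] at h
  rcases jacobiSym.trichotomy (f : ℤ) q with h0 | h0 | h0
  · rw [h0] at h
    rcases ht with rfl | rfl <;> norm_num at h
  · rw [h0] at h; simpa using h
  · rw [h0] at h; simpa using h

/-! ## §2 The Cohen dictionary on the cut, keyed on coprimality (any `±1` pattern) -/

section Dictionary

variable {p : ℕ} [hp : Fact p.Prime] {m : ℕ} [NeZero m] {χ : DirichletCharacter ℚ_[p] m} {k n₀ f : ℕ}
  {K : Type} [Field K] [NumberField K] {εK : DirichletCharacter ℚ_[p] (NumberField.discr K).natAbs}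

/-- **`(H(k, m n₀ f²) : ℚ_p) = −T_k(D', f) · (k⁻¹ · B_k((χ↑ε_K↑)~))`, `D' = χ(−1)·m·(−n₀)`** — w4 g12's `CohenCut.ratCast_cohenH_cut_eq`
with the all-split Jacobi clauses replaced by their only use, `gcd(m, n₀) = 1` (so it serves every `±1` sign pattern of the flipped-cusp
rung). [cite: Cohen1975, §2 (definition of H(r, N))] [cite: MontgomeryVaughan2007, Thm. 9.13] -/
theorem ratCast_cohenH_cut_eq_of_coprime (hχ : χ.IsPrimitive) (hχq : χ.IsQuadratic) {s : ℤ} (hs : χ (-1) = (s : ℚ_[p]))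
    (hs1 : s = 1 ∨ s = -1) (hpar : χ (-1) * (-1) ^ k = -1) (hsq : Squarefree n₀) (h4 : n₀ % 4 = 3) (hf : 0 < f)
    (hcop : m.Coprime n₀)
    (hK : IsImaginaryQuadratic K) (hdisc : NumberField.discr K = -(n₀ : ℤ)) (hεK : IsKroneckerCharacterOf K εK) :
    ((cohenH k (m * (n₀ * f ^ 2)) : ℚ) : ℚ_[p]) =
      -(cohenT k (s * m * -(n₀ : ℤ)) f : ℚ_[p]) * ((k : ℚ_[p])⁻¹ * @generalizedBernoulli ℚ_[p] _ _
        (changeLevel (dvd_mul_right m (NumberField.discr K).natAbs) χ *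
          changeLevel (dvd_mul_left (NumberField.discr K).natAbs m) εK).conductor ⟨conductor_ne_zero _⟩ k
        (changeLevel (dvd_mul_right m (NumberField.discr K).natAbs) χ *
          changeLevel (dvd_mul_left (NumberField.discr K).natAbs m) εK).primitiveCharacter) := by
  rw [cohenH_eq (CohenCut.isDiscDecomposition_cut hχ hχq hs hs1 hpar hsq h4 hf hcop),
    CohenCut.generalizedBernoulli_primitiveCharacter_mul_eq hχ hχq hs hs1 hK.1 hsq h4 hdisc hεK hcop k, Rat.cast_mul,
    Rat.cast_intCast, lValueDisc, Rat.cast_div, Rat.cast_neg, Rat.cast_natCast, ← eq_ratCast (algebraMap ℚ ℚ_[p])]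
  ring

/-- **A non-unit field factor forces a non-unit Cohen number**: `‖k⁻¹B_k((χ↑ε_K↑)~)‖_p ≤ p⁻¹ ⟹ ‖H(k, m n₀ f²)‖_p ≤ p⁻¹` (`T_k ∈ ℤ`).
[cite: Cohen1975, §2 (definition of H(r, N))] -/
theorem norm_ratCast_cohenH_cut_le_of_norm_bernoulli_le (hχ : χ.IsPrimitive) (hχq : χ.IsQuadratic) (hpar : χ (-1) * (-1) ^ k = -1)
    (hsq : Squarefree n₀) (h4 : n₀ % 4 = 3) (hf : 0 < f) (hcop : m.Coprime n₀)
    (hK : IsImaginaryQuadratic K) (hdisc : NumberField.discr K = -(n₀ : ℤ)) (hεK : IsKroneckerCharacterOf K εK)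
    (hB : ‖(k : ℚ_[p])⁻¹ * @generalizedBernoulli ℚ_[p] _ _
        (changeLevel (dvd_mul_right m (NumberField.discr K).natAbs) χ *
          changeLevel (dvd_mul_left (NumberField.discr K).natAbs m) εK).conductor ⟨conductor_ne_zero _⟩ k
        (changeLevel (dvd_mul_right m (NumberField.discr K).natAbs) χ *
          changeLevel (dvd_mul_left (NumberField.discr K).natAbs m) εK).primitiveCharacter‖ ≤ (p : ℝ)⁻¹) :
    ‖((cohenH k (m * (n₀ * f ^ 2)) : ℚ) : ℚ_[p])‖ ≤ (p : ℝ)⁻¹ := by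
  obtain ⟨s, hs1', hs⟩ := PrimitiveQuadratic.exists_sign_eq_of_charZero χ
  have hs1 : s = 1 ∨ s = -1 := by rcases hs1' with ⟨h, -⟩ | ⟨h, -⟩ <;> simp [h]
  rw [ratCast_cohenH_cut_eq_of_coprime hχ hχq hs hs1 hpar hsq h4 hf hcop hK hdisc hεK, norm_mul, norm_neg]
  calc ‖(cohenT k (s * m * -(n₀ : ℤ)) f : ℚ_[p])‖ * ‖(k : ℚ_[p])⁻¹ * @generalizedBernoulli ℚ_[p] _ _
        (changeLevel (dvd_mul_right m (NumberField.discr K).natAbs) χ *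
          changeLevel (dvd_mul_left (NumberField.discr K).natAbs m) εK).conductor ⟨conductor_ne_zero _⟩ k
        (changeLevel (dvd_mul_right m (NumberField.discr K).natAbs) χ *
          changeLevel (dvd_mul_left (NumberField.discr K).natAbs m) εK).primitiveCharacter‖
      ≤ 1 * ‖(k : ℚ_[p])⁻¹ * @generalizedBernoulli ℚ_[p] _ _
        (changeLevel (dvd_mul_right m (NumberField.discr K).natAbs) χ *
          changeLevel (dvd_mul_left (NumberField.discr K).natAbs m) εK).conductor ⟨conductor_ne_zero _⟩ k
        (changeLevel (dvd_mul_right m (NumberField.discr K).natAbs) χ *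
          changeLevel (dvd_mul_left (NumberField.discr K).natAbs m) εK).primitiveCharacter‖ := by
        gcongr
        exact Padic.norm_int_le_one _
    _ ≤ (p : ℝ)⁻¹ := by rw [one_mul]; exact hB

/-- **At a fundamental index (`f = 1`) the field factor and the Cohen number have the same norm**: `‖k⁻¹B_k((χ↑ε_K↑)~)‖_p = ‖H(k, m n₀)‖_p`
(`T_k(D', 1) = 1`). [cite: Cohen1975, §2 (definition of H(r, N))] -/
theorem norm_bernoulli_eq_norm_ratCast_cohenH (hχ : χ.IsPrimitive) (hχq : χ.IsQuadratic) (hpar : χ (-1) * (-1) ^ k = -1)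
    (hsq : Squarefree n₀) (h4 : n₀ % 4 = 3) (hcop : m.Coprime n₀)
    (hK : IsImaginaryQuadratic K) (hdisc : NumberField.discr K = -(n₀ : ℤ)) (hεK : IsKroneckerCharacterOf K εK) :
    ‖(k : ℚ_[p])⁻¹ * @generalizedBernoulli ℚ_[p] _ _
        (changeLevel (dvd_mul_right m (NumberField.discr K).natAbs) χ *
          changeLevel (dvd_mul_left (NumberField.discr K).natAbs m) εK).conductor ⟨conductor_ne_zero _⟩ k
        (changeLevel (dvd_mul_right m (NumberField.discr K).natAbs) χ *
          changeLevel (dvd_mul_left (NumberField.discr K).natAbs m) εK).primitiveCharacter‖ = ‖((cohenH k (m * n₀) : ℚ) : ℚ_[p])‖ := by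
  obtain ⟨s, hs1', hs⟩ := PrimitiveQuadratic.exists_sign_eq_of_charZero χ
  have hs1 : s = 1 ∨ s = -1 := by rcases hs1' with ⟨h, -⟩ | ⟨h, -⟩ <;> simp [h]
  have h := ratCast_cohenH_cut_eq_of_coprime hχ hχq hs hs1 hpar hsq h4 one_pos hcop hK hdisc hεK
  rw [cohenT_one, one_pow, mul_one] at h
  rw [h, neg_mul, norm_neg, Int.cast_one, one_mul]

end Dictionary

/-! ## §3 (FlipRung⁶) ⟸ (Rung⁶) -/

/-- **THE FLIPPED-CUSP RUNG IN BERNOULLI CURRENCY FROM THE RUNG IN COHEN-NUMBER CURRENCY.** Hypothesis (Rung⁶): for every class datum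
`(p, m, χ, k)` of the six leaf primes, every sign pattern `τ` (`±1` on the odd primes of `m`) and every odd prime `q ∣ m` with
`p ∤ q·J(−1 | q) − 1` (`q* ≢ 1 (mod p)`): if `‖H(k, a)‖_p ≤ p⁻¹` at every index `a` with `m ∣ a`, `a/m ≡ 3 (mod 4)`, `J(−a/m | q') = τ(q')`
at the odd primes `q' ∣ m`, `a/m ≡ 7 (mod 8)` if `2 ∣ m`, `3 ∤ a/m`, then the same holds with `τ` flipped at `q` — this is what the modular
side (T1–T4: the `τ`-cut of Cohen's `H_k` read at the cusp `W_{q⁴}(∞)`, weights `1 ± q*`, Katz's q-expansion principle) delivers.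
Conclusion: (FlipRung⁶), the `hFlip` binder of `seedOffExc_of_flipRung_of_bad` VERBATIM. PROOF. (⇒ hypothesis of the rung) a cut index is
`a = m n₀ f²` with `n₀ ≡ 3 (4)` squarefree, `f` odd (`CohenCut.exists_eq_mul_sq_of_cut`); `K := ℚ(√−n₀)` is imaginary quadratic with
`d_K = −n₀` odd, `< −4` (`3 ∤ n₀` excludes `n₀ = 3`), prime to `3`, of pattern `τ` (`J(−n₀f² | q') = ±1 ⟹ J(−n₀ | q')` is the same),
`≡ 1 (mod 8)` when `2 ∣ m`; so its field factor is a non-unit by the Bernoulli hypothesis, and `H(k, a) = −T·(field factor)` with `T ∈ ℤ`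
(§2). (⇐ conclusion) for `K₀` of the flipped pattern, `a := m·|d_{K₀}|` is an index of the flipped cut, so `‖H(k, a)‖ ≤ p⁻¹` by the rung,
and at `f = 1` the field factor IS `−H(k, a)`. [cite: Cohen1975, §2 (definition of H(r, N)) and Thm. 3.1] [cite: Washington1997, Thm. 4.2] -/
theorem flipRung_six_of_rung
    (hRung : ∀ (p : ℕ) [Fact p.Prime] (m : ℕ) [NeZero m] (χ : DirichletCharacter ℚ_[p] m) (k : ℕ),
      (p = 7 ∨ p = 11 ∨ p = 19 ∨ p = 43 ∨ p = 67 ∨ p = 163) →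
      m.Coprime p → χ.IsPrimitive → χ.IsQuadratic → (k = (p + 1) / 4 ∨ k = (3 * p - 1) / 4) →
      2 ≤ k → k ≤ p - 2 → χ (-1) * (-1) ^ k = -1 →
      ∀ (τ : ℕ → ℤ) (q : ℕ), q.Prime → q ∣ m → q ≠ 2 →
      (∀ q' : ℕ, q'.Prime → q' ∣ m → q' ≠ 2 → (τ q' = 1 ∨ τ q' = -1)) →
      ¬ ((p : ℤ) ∣ (q : ℤ) * jacobiSym (-1) q - 1) →
      (∀ a : ℕ, m ∣ a → a / m % 4 = 3 →
        (∀ q' : ℕ, q'.Prime → q' ∣ m → q' ≠ 2 → jacobiSym (-((a / m : ℕ) : ℤ)) q' = τ q') →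
        (2 ∣ m → a / m % 8 = 7) → ¬ 3 ∣ a / m → ‖((cohenH k a : ℚ) : ℚ_[p])‖ ≤ (p : ℝ)⁻¹) →
      ∀ a : ℕ, m ∣ a → a / m % 4 = 3 →
        (∀ q' : ℕ, q'.Prime → q' ∣ m → q' ≠ 2 → jacobiSym (-((a / m : ℕ) : ℤ)) q' = (if q' = q then -τ q' else τ q')) →
        (2 ∣ m → a / m % 8 = 7) → ¬ 3 ∣ a / m → ‖((cohenH k a : ℚ) : ℚ_[p])‖ ≤ (p : ℝ)⁻¹) :
    ∀ (p : ℕ) [Fact p.Prime] (m : ℕ) [NeZero m] (χ : DirichletCharacter ℚ_[p] m) (k : ℕ),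
      (p = 7 ∨ p = 11 ∨ p = 19 ∨ p = 43 ∨ p = 67 ∨ p = 163) →
      m.Coprime p → χ.IsPrimitive → χ.IsQuadratic → (k = (p + 1) / 4 ∨ k = (3 * p - 1) / 4) →
      2 ≤ k → k ≤ p - 2 → χ (-1) * (-1) ^ k = -1 →
      ∀ (τ : ℕ → ℤ) (q : ℕ), q.Prime → q ∣ m → q ≠ 2 →
      (∀ q' : ℕ, q'.Prime → q' ∣ m → q' ≠ 2 → (τ q' = 1 ∨ τ q' = -1)) →
      ¬ ((p : ℤ) ∣ (q : ℤ) * jacobiSym (-1) q - 1) →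
      (∀ (K₀ : Type) [Field K₀] [NumberField K₀] (ε₀ : DirichletCharacter ℚ_[p] (NumberField.discr K₀).natAbs),
        IsImaginaryQuadratic K₀ → Odd (NumberField.discr K₀) → NumberField.discr K₀ < -4 →
        ¬ ((3 : ℤ) ∣ NumberField.discr K₀) →
        (∀ q' : ℕ, q'.Prime → q' ∣ m → q' ≠ 2 → jacobiSym (NumberField.discr K₀) q' = τ q') →
        (2 ∣ m → NumberField.discr K₀ % 8 = 1) → IsKroneckerCharacterOf K₀ ε₀ →
        ‖(k : ℚ_[p])⁻¹ * @generalizedBernoulli ℚ_[p] _ _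
            (changeLevel (dvd_mul_right m (NumberField.discr K₀).natAbs) χ *
              changeLevel (dvd_mul_left (NumberField.discr K₀).natAbs m) ε₀).conductor ⟨conductor_ne_zero _⟩ k
            (changeLevel (dvd_mul_right m (NumberField.discr K₀).natAbs) χ *
              changeLevel (dvd_mul_left (NumberField.discr K₀).natAbs m) ε₀).primitiveCharacter‖ ≤ (p : ℝ)⁻¹) →
      ∀ (K₀ : Type) [Field K₀] [NumberField K₀] (ε₀ : DirichletCharacter ℚ_[p] (NumberField.discr K₀).natAbs),
        IsImaginaryQuadratic K₀ → Odd (NumberField.discr K₀) → NumberField.discr K₀ < -4 →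
        ¬ ((3 : ℤ) ∣ NumberField.discr K₀) →
        (∀ q' : ℕ, q'.Prime → q' ∣ m → q' ≠ 2 → jacobiSym (NumberField.discr K₀) q' = (if q' = q then -τ q' else τ q')) →
        (2 ∣ m → NumberField.discr K₀ % 8 = 1) → IsKroneckerCharacterOf K₀ ε₀ →
        ‖(k : ℚ_[p])⁻¹ * @generalizedBernoulli ℚ_[p] _ _
            (changeLevel (dvd_mul_right m (NumberField.discr K₀).natAbs) χ *
              changeLevel (dvd_mul_left (NumberField.discr K₀).natAbs m) ε₀).conductor ⟨conductor_ne_zero _⟩ k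
            (changeLevel (dvd_mul_right m (NumberField.discr K₀).natAbs) χ *
              changeLevel (dvd_mul_left (NumberField.discr K₀).natAbs m) ε₀).primitiveCharacter‖ ≤ (p : ℝ)⁻¹ := by
  intro p _ m _ χ k hp6 hmp hχ hχq hk hk2 hkp hpar τ q hq hqm hq2 hτ hstar hHyp K₀ _ _ ε₀ hK hodd hlt h3 hpat h8 hε
  have hm0 : 0 < m := Nat.pos_of_ne_zero (NeZero.ne m)
  -- the flipped pattern is `±1`-valued
  have hτ' : ∀ q' : ℕ, q'.Prime → q' ∣ m → q' ≠ 2 →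
      ((fun x : ℕ => if x = q then -τ x else τ x) q' = 1 ∨ (fun x : ℕ => if x = q then -τ x else τ x) q' = -1) := by
    intro q' hq' hq'm hq'2
    rcases hτ q' hq' hq'm hq'2 with h | h
    · by_cases hqq : q' = q
      · subst hqq; simp [h]
      · simp [hqq, h]
    · by_cases hqq : q' = q
      · subst hqq; simp [h]
      · simp [hqq, h]
  -- Step 1: the hypothesis of the rung on the `τ`-cut, from the Bernoulli hypothesis through the dictionary
  have hcut : ∀ a : ℕ, m ∣ a → a / m % 4 = 3 →
      (∀ q' : ℕ, q'.Prime → q' ∣ m → q' ≠ 2 → jacobiSym (-((a / m : ℕ) : ℤ)) q' = τ q') →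
      (2 ∣ m → a / m % 8 = 7) → ¬ 3 ∣ a / m → ‖((cohenH k a : ℚ) : ℚ_[p])‖ ≤ (p : ℝ)⁻¹ := by
    intro a hma ha4 hJ h8a h3a
    obtain ⟨n₀, f, hsq, hn4, hf, rfl, hdiv⟩ := CohenCut.exists_eq_mul_sq_of_cut hma ha4
    rw [hdiv] at hJ h8a h3a
    obtain ⟨-, -, hn8⟩ := ThetaCycle.mod_four_of_sq_mul (f := f) (n₁ := n₀) (by rw [mul_comm, ← hdiv]; exact ha4)
    have hn3 : ¬ 3 ∣ n₀ := fun h => h3a (dvd_mul_of_dvd_left h _)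
    have hn7 : 4 < n₀ := by
      have : n₀ ≠ 3 := fun h => hn3 (h ▸ dvd_rfl)
      omega
    -- the field `K = ℚ(√−n₀)` and its Kronecker character
    have hsqZ : Squarefree (-(n₀ : ℤ)) := by
      rw [← Int.squarefree_natAbs, Int.natAbs_neg, Int.natAbs_natCast]; exact hsq
    obtain ⟨K, iF, iN, h2, hd⟩ := Quadratic.exists_numberField_discr_eq (D := -(n₀ : ℤ))
      (Or.inl ⟨by omega, hsqZ, by omega⟩)
    have hKim : IsImaginaryQuadratic K := isImaginaryQuadratic_of_discr_eq_of_neg h2 hd (by omega)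
    obtain ⟨εK, hεK, -⟩ :=
      KrizLiBinders.exists_isKroneckerCharacterOf_of_discr (p := p) h2 (m := n₀) hsq (Or.inr ⟨hd, hn4⟩)
    -- the Bernoulli hypothesis at `(K, ε_K)`
    have hB := hHyp K εK hKim (by rw [hd, Int.odd_iff]; omega) (by rw [hd]; omega)
      (by rw [hd, Int.dvd_neg]; exact_mod_cast hn3)
      (fun q' hq' hq'm hq'2 => by rw [hd]; exact jacobiSym_neg_eq_of_neg_mul_sq (hτ q' hq' hq'm hq'2) (hJ q' hq' hq'm hq'2))
      (fun h2m => by rw [hd]; have := hn8 (by rw [mul_comm]; exact h8a h2m); omega) hεK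
    -- the dictionary
    exact norm_ratCast_cohenH_cut_le_of_norm_bernoulli_le hχ hχq hpar hsq hn4 hf (coprime_of_cut_sign hn4 hτ hJ) hKim hd hεK hB
  -- Step 2: the rung, then read its conclusion at the fundamental index `a = m·|d_K₀|`
  have hflip := hRung p m χ k hp6 hmp hχ hχq hk hk2 hkp hpar τ q hq hqm hq2 hτ hstar hcut
  -- `d_K₀ = −n₀`, `n₀ ≡ 3 (4)` squarefree, prime to `3`
  rcases Quadratic.isFundamentalDiscriminant_discr (K := K₀) hK.1 with ⟨hd4, hsqd, -⟩ | ⟨hd4, -, -⟩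
  swap
  · exfalso
    rw [Int.odd_iff] at hodd
    omega
  obtain ⟨n₀, hn₀⟩ : ∃ n₀ : ℕ, NumberField.discr K₀ = -(n₀ : ℤ) :=
    ⟨(NumberField.discr K₀).natAbs, by rw [Int.ofNat_natAbs_of_nonpos (by omega)]; ring⟩
  have hn4 : n₀ % 4 = 3 := by omega
  have hsq : Squarefree n₀ := by
    have h := Int.squarefree_natAbs.mpr hsqd
    rwa [hn₀, Int.natAbs_neg, Int.natAbs_natCast] at h
  have hn3 : ¬ 3 ∣ n₀ := fun h => h3 (by rw [hn₀, Int.dvd_neg]; exact_mod_cast h)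
  have hdiv : m * (n₀ * 1 ^ 2) / m = n₀ := by rw [one_pow, mul_one, Nat.mul_div_cancel_left _ hm0]
  have hJ' : ∀ q' : ℕ, q'.Prime → q' ∣ m → q' ≠ 2 →
      jacobiSym (-((n₀ * 1 ^ 2 : ℕ) : ℤ)) q' = (fun x : ℕ => if x = q then -τ x else τ x) q' := by
    intro q' hq' hq'm hq'2
    rw [show (-((n₀ * 1 ^ 2 : ℕ) : ℤ)) = NumberField.discr K₀ by rw [hn₀]; push_cast; ring]
    exact hpat q' hq' hq'm hq'2
  have hHa := hflip (m * (n₀ * 1 ^ 2)) (dvd_mul_right _ _) (by rw [hdiv]; exact hn4)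
    (fun q' hq' hq'm hq'2 => by
      rw [hdiv, ← hn₀]
      exact hpat q' hq' hq'm hq'2)
    (fun h2m => by rw [hdiv]; have := h8 h2m; omega) (by rw [hdiv]; exact hn3)
  have hcop : m.Coprime n₀ := coprime_of_cut_sign (f := 1) hn4 hτ' hJ'
  rw [norm_bernoulli_eq_norm_ratCast_cohenH hχ hχq hpar hsq hn4 hcop hK hn₀ hε]
  simpa using hHa

end Summit.BirchSwinnertonDyer.BirchSwinnertonDyer.Theorems.PrintCFram.FlipRung

end
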